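import Summits.ABC.ABC.Theses.IneffectiveSubspace
import Literature.NumberTheory.DiophantineGeometry.AbcImpliesHall

/-!
# `TowerExponentWindow` (stmt-ABC-1647) — negative-side lemmas IV: the lever of line
`binomial-xi-d-zero-threefold` is sandwiched, `PolyABC_{κ<3/2} ⟹ stub_binomialDepthWindow (⟹ PolyABC)`

Standing-adversary (cdisprove, gen 2) output, `-- Targets` part, costume-distance measurement.  The skeleton
`Cruxes/TowerExponentWindow/Lines/binomial-xi-d-zero-threefold.lean` proves `ABC ⟹ lever` (level `10`, `C = 3`)
and `lever ⟹ (stubs B, C) ⟹ PolyABC ⟺ crux`.  Sharper upper bracket, proved here with the stub spelled out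
verbatim (no auxiliary definitions):

* `depth_core_of_polyAbc`, `depth_of_polyAbc` — polynomial abc `c < K·rad(abc)^κ` (`0 < κ`) gives the depth
  inequality at EVERY level `n ≥ 1` with `C = 2 + n·max(κ−1,0)/κ`, `C' = max (log K) 0 / κ`
  (apply abc to `(P − Q, Q, P)`, `P = a₁a₂ⁿ`, `Q = c₁c₂ⁿ`, and `rad(P − Q) ≤ rad d·(P − Q)/d`);
* `depth_window_of_polyAbc` — **polynomial abc with ANY exponent `κ < 3/2` implies the lever** (the window
  `3C < n` opens at `n > 6κ/(3 − 2κ)` because `max(κ−1,0)/κ < 1/3`); `depth_window_of_abc` — the abc case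
  (`ε = 1/4`).

So the lever sits in `[PolyABC_{<3/2}, PolyABC_{<∞}]` inside the crux's equivalence class (crux ⟺ PolyABC,
`Cruxes/TowerExponentWindow/Disproof.lean`): not the crux in costume, but implied by a very mild strengthening
of it and at least as hard.  Refuter seat cdisprove-stmt-ABC-1647 (gen 2), 2026-08-16.
-/

namespace Summit.ABC.ABC.Theorems.TowerExponentWindow.Negative

open Literature.NumberTheory.DiophantineGeometry

/-- Core of the sandwich, orientation `c₁c₂ⁿ < a₁a₂ⁿ`: polynomial abc applied to the triple `(P − Q, Q, P)`
and `rad(P − Q) ≤ rad d · (P − Q)/d` give the depth bound with `C = 2 + n·max(κ−1,0)/κ`. [folklore] -/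
theorem depth_core_of_polyAbc {κ K : ℝ} (hκ : 0 < κ) (hK : 0 < K)
    (hP : ∀ a b c : ℕ, IsABCTriple a b c → (c : ℝ) < K * ((rad a b c : ℕ) : ℝ) ^ κ)
    {n a₁ a₂ c₁ c₂ d : ℕ} (hn : 1 ≤ n) (ha₁ : 0 < a₁) (ha₂ : 0 < a₂) (hc₁ : 0 < c₁) (hc₂ : 0 < c₂)
    (hcop : Nat.Coprime (a₁ * a₂) (c₁ * c₂)) (hlt : c₁ * c₂ ^ n < a₁ * a₂ ^ n) (hd : 0 < d)
    (hdvd : (d : ℤ) ∣ ((a₁ * a₂ ^ n : ℕ) : ℤ) - ((c₁ * c₂ ^ n : ℕ) : ℤ)) :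
    Real.log (d : ℝ) ≤ (2 + n * (max (κ - 1) 0 / κ)) * (Real.log ((max a₁ c₁ : ℕ) : ℝ) +
      Real.log ((max a₂ c₂ : ℕ) : ℝ) + Real.log ((UniqueFactorizationMonoid.radical d : ℕ) : ℝ)) +
      max (Real.log K) 0 / κ := by
  set P : ℕ := a₁ * a₂ ^ n with hPdef
  set Q : ℕ := c₁ * c₂ ^ n with hQdef
  have hn0 : n ≠ 0 := by omega
  have hP0 : 0 < P := by positivity
  have hQ0 : 0 < Q := by positivity
  -- `d ∣ P - Q` in `ℕ`
  obtain ⟨e, he⟩ : d ∣ P - Q := by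
    have h1 : ((P - Q : ℕ) : ℤ) = (P : ℤ) - (Q : ℤ) := Nat.cast_sub hlt.le
    have h2 : (d : ℤ) ∣ ((P - Q : ℕ) : ℤ) := by rw [h1]; exact hdvd
    exact Int.natCast_dvd_natCast.mp h2
  have hD0 : 0 < P - Q := Nat.sub_pos_of_lt hlt
  have he0 : 0 < e := by
    rcases Nat.eq_zero_or_pos e with h | h
    · rw [h, mul_zero] at he; omega
    · exact h
  -- `(P - Q, Q, P)` is an abc triple
  have hPd : P ∣ (a₁ * a₂) ^ n := by
    rw [mul_pow]; exact mul_dvd_mul (dvd_pow_self a₁ hn0) dvd_rfl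
  have hQd : Q ∣ (c₁ * c₂) ^ n := by
    rw [mul_pow]; exact mul_dvd_mul (dvd_pow_self c₁ hn0) dvd_rfl
  have hPQ : Nat.Coprime P Q :=
    Nat.Coprime.coprime_dvd_left hPd (Nat.Coprime.coprime_dvd_right hQd (Nat.Coprime.pow n n hcop))
  have hDQ : Nat.Coprime (P - Q) Q := (Nat.coprime_sub_self_left hlt.le).mpr hPQ
  have habc3 : IsABCTriple (P - Q) Q P := ⟨hD0, hQ0, Nat.sub_add_cancel hlt.le, hDQ⟩
  have hmain := hP _ _ _ habc3
  -- the radical bound in `ℕ`: `rad((P-Q)·Q·P) ≤ rad d · e · c₁c₂ · a₁a₂`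
  have hDrad : UniqueFactorizationMonoid.radical (P - Q) ≤ UniqueFactorizationMonoid.radical d * e := by
    rw [he]
    calc UniqueFactorizationMonoid.radical (d * e)
        ≤ UniqueFactorizationMonoid.radical d * UniqueFactorizationMonoid.radical e :=
          Nat.le_of_dvd (mul_pos (Nat.radical_pos _) (Nat.radical_pos _))
            UniqueFactorizationMonoid.radical_mul_dvd
      _ ≤ UniqueFactorizationMonoid.radical d * e :=
          Nat.mul_le_mul_left _ (Nat.radical_le_self_iff.mpr he0.ne')
  have hQrad : UniqueFactorizationMonoid.radical Q ≤ c₁ * c₂ :=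
    radical_le_of_dvd_pow (n := n) (by positivity) hQd
  have hPrad : UniqueFactorizationMonoid.radical P ≤ a₁ * a₂ :=
    radical_le_of_dvd_pow (n := n) (by positivity) hPd
  have hradN : rad (P - Q) Q P ≤ UniqueFactorizationMonoid.radical d * e * (c₁ * c₂) * (a₁ * a₂) := by
    rw [rad_def]
    exact (radical_mul_three_le _ _ _).trans (Nat.mul_le_mul (Nat.mul_le_mul hDrad hQrad) hPrad)
  -- real-side facts
  set R : ℝ := ((rad (P - Q) Q P : ℕ) : ℝ) with hRdef
  have hR1 : (1 : ℝ) ≤ R := by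
    have h : rad (P - Q) Q P ≠ 0 := by rw [rad_def]; exact UniqueFactorizationMonoid.radical_ne_zero
    have h' : (1 : ℕ) ≤ rad (P - Q) Q P := Nat.one_le_iff_ne_zero.mpr h
    rw [hRdef]; exact_mod_cast h'
  have hR0 : 0 < R := by linarith
  have hPR : (0 : ℝ) < (P : ℝ) := by exact_mod_cast hP0
  have hdR : (0 : ℝ) < (d : ℝ) := by exact_mod_cast hd
  have heR : (0 : ℝ) < (e : ℝ) := by exact_mod_cast he0
  have ha₁R : (0 : ℝ) < (a₁ : ℝ) := by exact_mod_cast ha₁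
  have ha₂R : (0 : ℝ) < (a₂ : ℝ) := by exact_mod_cast ha₂
  have hc₁R : (0 : ℝ) < (c₁ : ℝ) := by exact_mod_cast hc₁
  have hc₂R : (0 : ℝ) < (c₂ : ℝ) := by exact_mod_cast hc₂
  have hrdR : (0 : ℝ) < ((UniqueFactorizationMonoid.radical d : ℕ) : ℝ) := by
    exact_mod_cast Nat.radical_pos d
  -- (1) polynomial abc, logarithmically
  have h1 : Real.log (P : ℝ) < Real.log K + κ * Real.log R := by
    have h := Real.log_lt_log hPR hmain
    rwa [Real.log_mul hK.ne' (Real.rpow_pos_of_pos hR0 _).ne', Real.log_rpow hR0] at h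
  -- (2) the radical bound, logarithmically
  have h2 : Real.log R ≤ Real.log ((UniqueFactorizationMonoid.radical d : ℕ) : ℝ) + Real.log (e : ℝ) +
      (Real.log (c₁ : ℝ) + Real.log (c₂ : ℝ)) + (Real.log (a₁ : ℝ) + Real.log (a₂ : ℝ)) := by
    have hcast : R ≤ ((UniqueFactorizationMonoid.radical d : ℕ) : ℝ) * (e : ℝ) * ((c₁ : ℝ) * (c₂ : ℝ)) *
        ((a₁ : ℝ) * (a₂ : ℝ)) := by
      rw [hRdef]; exact_mod_cast hradN
    have h := Real.log_le_log hR0 hcast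
    rwa [Real.log_mul (mul_pos (mul_pos hrdR heR) (mul_pos hc₁R hc₂R)).ne' (mul_pos ha₁R ha₂R).ne',
      Real.log_mul (mul_pos hrdR heR).ne' (mul_pos hc₁R hc₂R).ne', Real.log_mul hrdR.ne' heR.ne',
      Real.log_mul hc₁R.ne' hc₂R.ne', Real.log_mul ha₁R.ne' ha₂R.ne'] at h
  -- (3) `d · e = P - Q ≤ P`
  have h3 : Real.log (d : ℝ) + Real.log (e : ℝ) ≤ Real.log (P : ℝ) := by
    have hDP : ((P - Q : ℕ) : ℝ) ≤ (P : ℝ) := by exact_mod_cast Nat.sub_le P Q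
    have hDe : ((P - Q : ℕ) : ℝ) = (d : ℝ) * (e : ℝ) := by rw [he]; push_cast; ring
    have h := Real.log_le_log (by rw [hDe]; positivity) hDP
    rwa [hDe, Real.log_mul hdR.ne' heR.ne'] at h
  -- (4) heights
  have h4 : Real.log (P : ℝ) = Real.log (a₁ : ℝ) + n * Real.log (a₂ : ℝ) := by
    have : (P : ℝ) = (a₁ : ℝ) * (a₂ : ℝ) ^ n := by rw [hPdef]; push_cast; ring
    rw [this, Real.log_mul ha₁R.ne' (pow_pos ha₂R n).ne', Real.log_pow]
  have h5a : Real.log (a₁ : ℝ) ≤ Real.log ((max a₁ c₁ : ℕ) : ℝ) :=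
    Real.log_le_log ha₁R (by exact_mod_cast le_max_left a₁ c₁)
  have h5c : Real.log (c₁ : ℝ) ≤ Real.log ((max a₁ c₁ : ℕ) : ℝ) :=
    Real.log_le_log hc₁R (by exact_mod_cast le_max_right a₁ c₁)
  have h6a : Real.log (a₂ : ℝ) ≤ Real.log ((max a₂ c₂ : ℕ) : ℝ) :=
    Real.log_le_log ha₂R (by exact_mod_cast le_max_left a₂ c₂)
  have h6c : Real.log (c₂ : ℝ) ≤ Real.log ((max a₂ c₂ : ℕ) : ℝ) :=
    Real.log_le_log hc₂R (by exact_mod_cast le_max_right a₂ c₂)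
  have h9 : 0 ≤ Real.log ((UniqueFactorizationMonoid.radical d : ℕ) : ℝ) :=
    Real.log_nonneg (by exact_mod_cast Nat.succ_le_of_lt (Nat.radical_pos d))
  have h10 : 0 ≤ Real.log (a₁ : ℝ) := Real.log_nonneg (by exact_mod_cast ha₁)
  have h11 : 0 ≤ Real.log (a₂ : ℝ) := Real.log_nonneg (by exact_mod_cast ha₂)
  have hm1 : Real.log K ≤ max (Real.log K) 0 := le_max_left _ _
  have hn1 : (1 : ℝ) ≤ n := by exact_mod_cast hn
  -- abbreviations
  set H1 : ℝ := Real.log ((max a₁ c₁ : ℕ) : ℝ) with hH1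
  set H2 : ℝ := Real.log ((max a₂ c₂ : ℕ) : ℝ) with hH2
  set Lr : ℝ := Real.log ((UniqueFactorizationMonoid.radical d : ℕ) : ℝ) with hLr
  set LP : ℝ := Real.log (P : ℝ) with hLP
  set μ : ℝ := max (κ - 1) 0 with hμ
  have hμ0 : 0 ≤ μ := le_max_right _ _
  have hH1n : 0 ≤ H1 := h10.trans h5a
  have hH2n : 0 ≤ H2 := h11.trans h6a
  have hLP0 : 0 ≤ LP := by
    rw [h4]; have : 0 ≤ (n : ℝ) * Real.log (a₂ : ℝ) := by positivity
    linarith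
  have hLPle : LP ≤ H1 + n * H2 := by
    rw [h4]
    have : (n : ℝ) * Real.log (a₂ : ℝ) ≤ n * H2 := mul_le_mul_of_nonneg_left h6a (by positivity)
    linarith
  -- products
  have sA : Real.log R ≤ Lr + Real.log (e : ℝ) + 2 * H1 + 2 * H2 := by linarith
  have sB : κ * Real.log R ≤ κ * (Lr + Real.log (e : ℝ) + 2 * H1 + 2 * H2) :=
    mul_le_mul_of_nonneg_left sA hκ.le
  have c1 : κ * (Real.log (d : ℝ) + Real.log (e : ℝ)) ≤ κ * LP := mul_le_mul_of_nonneg_left h3 hκ.le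
  have hμP : (κ - 1) * LP ≤ μ * (H1 + n * H2) := by
    rcases le_or_gt κ 1 with hk | hk
    · have h0 : (κ - 1) * LP ≤ 0 := mul_nonpos_of_nonpos_of_nonneg (by linarith) hLP0
      have h0' : 0 ≤ μ * (H1 + n * H2) := by positivity
      linarith
    · have hμe : μ = κ - 1 := max_eq_left (by linarith)
      rw [hμe]; exact mul_le_mul_of_nonneg_left hLPle (by linarith)
  have hμn : μ * (H1 + n * H2) ≤ μ * (n * (H1 + H2)) := by
    refine mul_le_mul_of_nonneg_left ?_ hμ0
    have : H1 ≤ n * H1 := le_mul_of_one_le_left hH1n hn1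
    linarith
  have hμLr : 0 ≤ μ * (n * Lr) := by positivity
  have hκLr : 0 ≤ κ * Lr := by positivity
  -- conclude: κ · log d ≤ (2κ + nμ)·(H1 + H2 + Lr) + max (log K) 0, then divide by κ
  have hfin : κ * Real.log (d : ℝ) ≤ (2 * κ + n * μ) * (H1 + H2 + Lr) + max (Real.log K) 0 := by
    linarith
  have hgoal : κ * Real.log (d : ℝ) ≤ κ * ((2 + n * (μ / κ)) * (H1 + H2 + Lr) + max (Real.log K) 0 / κ) := by
    have e : κ * ((2 + n * (μ / κ)) * (H1 + H2 + Lr) + max (Real.log K) 0 / κ)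
        = (2 * κ + n * μ) * (H1 + H2 + Lr) + max (Real.log K) 0 := by
      field_simp
    rw [e]; exact hfin
  exact le_of_mul_le_mul_left hgoal hκ


/-- **Polynomial abc (`0 < κ`) gives the depth inequality at every level `n ≥ 1`** with
`C = 2 + n·max(κ−1,0)/κ`, `C' = max (log K) 0 / κ`. [folklore] -/
theorem depth_of_polyAbc {κ K : ℝ} (hκ : 0 < κ) (hK : 0 < K)
    (hP : ∀ a b c : ℕ, IsABCTriple a b c → (c : ℝ) < K * ((rad a b c : ℕ) : ℝ) ^ κ) {n : ℕ} (hn : 1 ≤ n) :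
    ∀ a₁ a₂ c₁ c₂ : ℕ, 0 < a₁ → 0 < a₂ → 0 < c₁ → 0 < c₂ → Nat.Coprime (a₁ * a₂) (c₁ * c₂) →
      a₁ * a₂ ^ n ≠ c₁ * c₂ ^ n → ∀ d : ℕ, 0 < d → (d : ℤ) ∣ ((a₁ * a₂ ^ n : ℕ) : ℤ) - ((c₁ * c₂ ^ n : ℕ) : ℤ) →
      Real.log (d : ℝ) ≤ (2 + n * (max (κ - 1) 0 / κ)) * (Real.log ((max a₁ c₁ : ℕ) : ℝ) +
        Real.log ((max a₂ c₂ : ℕ) : ℝ) + Real.log ((UniqueFactorizationMonoid.radical d : ℕ) : ℝ)) +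
        max (Real.log K) 0 / κ := by
  intro a₁ a₂ c₁ c₂ ha₁ ha₂ hc₁ hc₂ hcop hne d hd hdvd
  rcases Nat.lt_or_gt_of_ne hne with hlt | hlt
  · have h := depth_core_of_polyAbc hκ hK hP hn hc₁ hc₂ ha₁ ha₂ hcop.symm hlt hd (dvd_sub_comm.mp hdvd)
    rwa [max_comm c₁ a₁, max_comm c₂ a₂] at h
  · exact depth_core_of_polyAbc hκ hK hP hn ha₁ ha₂ hc₁ hc₂ hcop hlt hd hdvd

/-- **Polynomial abc with any exponent `κ < 3/2` implies the lever `stub_binomialDepthWindow`**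
(verbatim the registered stub of line `binomial-xi-d-zero-threefold`). [folklore] -/
theorem depth_window_of_polyAbc {κ K : ℝ} (hκ : 0 < κ) (hκ3 : κ < 3 / 2) (hK : 0 < K)
    (hP : ∀ a b c : ℕ, IsABCTriple a b c → (c : ℝ) < K * ((rad a b c : ℕ) : ℝ) ^ κ) :
    ∃ n : ℕ, ∃ C C' : ℝ, 0 ≤ C ∧ 3 * C < n ∧ ∀ a₁ a₂ c₁ c₂ : ℕ, 0 < a₁ → 0 < a₂ → 0 < c₁ → 0 < c₂ → Nat.Coprime (a₁ * a₂) (c₁ * c₂) → a₁ * a₂ ^ n ≠ c₁ * c₂ ^ n → ∀ d : ℕ, 0 < d → (d : ℤ) ∣ ((a₁ * a₂ ^ n : ℕ) : ℤ) - ((c₁ * c₂ ^ n : ℕ) : ℤ) → Real.log (d : ℝ) ≤ C * (Real.log ((max a₁ c₁ : ℕ) : ℝ) + Real.log ((max a₂ c₂ : ℕ) : ℝ) + Real.log ((UniqueFactorizationMonoid.radical d : ℕ) : ℝ)) + C' := by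
  set θ : ℝ := max (κ - 1) 0 / κ with hθ
  have hθ0 : 0 ≤ θ := div_nonneg (le_max_right _ _) hκ.le
  have hθ3 : θ < 1 / 3 := by
    rw [hθ, div_lt_iff₀ hκ]
    rcases le_or_gt κ 1 with hk | hk
    · rw [max_eq_right (by linarith)]; linarith
    · rw [max_eq_left (by linarith)]; linarith
  have hg : 0 < 1 - 3 * θ := by linarith
  obtain ⟨n, hn⟩ := exists_nat_gt (6 / (1 - 3 * θ))
  have hn6 : 6 < (n : ℝ) * (1 - 3 * θ) := (div_lt_iff₀ hg).mp hn
  have hn1 : 1 ≤ n := by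
    rcases Nat.eq_zero_or_pos n with h0 | h0
    · subst h0; norm_num at hn6
    · exact h0
  refine ⟨n, 2 + n * θ, max (Real.log K) 0 / κ, by positivity, by nlinarith, ?_⟩
  exact depth_of_polyAbc hκ hK hP hn1

/-- **`ABC ⟹` the lever** (abc at `ε = 1/4`, `κ = 5/4 < 3/2`), recovering the skeleton's
`binomialDepthWindow_of_abc` from the general sandwich. [folklore] -/
theorem depth_window_of_abc (habc : ABC) :
    ∃ n : ℕ, ∃ C C' : ℝ, 0 ≤ C ∧ 3 * C < n ∧ ∀ a₁ a₂ c₁ c₂ : ℕ, 0 < a₁ → 0 < a₂ → 0 < c₁ → 0 < c₂ → Nat.Coprime (a₁ * a₂) (c₁ * c₂) → a₁ * a₂ ^ n ≠ c₁ * c₂ ^ n → ∀ d : ℕ, 0 < d → (d : ℤ) ∣ ((a₁ * a₂ ^ n : ℕ) : ℤ) - ((c₁ * c₂ ^ n : ℕ) : ℤ) → Real.log (d : ℝ) ≤ C * (Real.log ((max a₁ c₁ : ℕ) : ℝ) + Real.log ((max a₂ c₂ : ℕ) : ℝ) + Real.log ((UniqueFactorizationMonoid.radical d : ℕ) : ℝ))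 + C' := by
  obtain ⟨K, hK, hall⟩ := habc ((1 : ℝ) / 4) (by norm_num)
  exact depth_window_of_polyAbc (κ := 1 + 1 / 4) (by norm_num) (by norm_num) hK hall

end Summit.ABC.ABC.Theorems.TowerExponentWindow.Negative
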